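import Mathlib
import Summits.MatrixMultiplication.MatrixMultiplication.Theorems.SnSubsetDichotomyPolynomialSlackBlockCost
import Summits.MatrixMultiplication.MatrixMultiplication.Theorems.SnSubsetDichotomyPolynomialSlackStubSplit
import Summits.MatrixMultiplication.MatrixMultiplication.Theorems.SnSubsetDichotomyPolynomialSlackMarginals

/-!
# The dyadic hub lemma: the block-cost step

Crux `Summit.MatrixMultiplication.MatrixMultiplication.Theses.SnSubsetDichotomy.PolynomialSlack`
(item `stmt-MatrixMultiplication-8306`), level-one programme, lead c8 (general hub lemma, block cost
step), line transport-split-hull, registered stub `hubBlock_card_le`.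

For a TPP triple `S, T, U ⊆ S_n` with quotient profiles `d_A = m_{ST}/|S||T|`, `d_B = m_{TU}/|T||U|`,
`d_C = m_{US}/|U||S|`, a hub position `k`, and dyadic blocks `J₀` (on which `d_B(·,k) ∈ [β, 2β]`) and
`I₀` (on which `d_C(k,·) ∈ [γ, 2γ]`) of masses `Σ_{J₀} d_B(·,k) ≥ 2q` and `Σ_{I₀} d_C(k,·) ≥ 2q`, the
smallness `Σ_{I₀ × J₀} d_A·d_B·d_C ≤ η/n` with `η ≤ 2q²` forces

  `|J₀|·|I₀| ≤ 9600·(1 + log n)·n·log(6·n!/(|S||T|))`      (`hubBlock_card_le`).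

Proof: apply `block_cost` (file `…BlockCost`) to the quotient set `A = S⁻¹T` (`|A| = |S||T|` by the
injectivity `injOn_quot_first` of `(s,t) ↦ s⁻¹t` on `S × T`), the block `J₀ × I₀`, the weights
`d_B(·,k)` and `d_C(k,·)`, and the ratio `ρ = 2` (`600·2⁴ = 9600`). Its deficit hypothesis follows from
the fibre identity `Σ_{a ∈ A} Σ_{j ∈ J₀, a j ∈ I₀} d_B(j,k)·d_C(k, a j) = |A|·Σ_{I₀ × J₀} d_A·d_B·d_C`
(`#{a ∈ A : a j = i} = m_{ST}(i,j) = |S||T|·d_A(i,j)`, `pairMarginal_eq_marginal_image₂`), which is at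
most `|A|·η/n ≤ |A|·2q²/n ≤ |A|·(Σ_{J₀} d_B)(Σ_{I₀} d_C)/(2n)`.
-/

namespace Summit.MatrixMultiplication.MatrixMultiplication.Theorems.PolynomialSlack

set_option linter.dupNamespace false

open scoped BigOperators
open Literature.Combinatorics.Additive (TripleProductProperty)

/-- Fibring the weighted hit statistic over the value `i = a j`:
`Σ_{a ∈ A} Σ_{j ∈ J, a j ∈ I} w_T(j)·w_S(a j) = Σ_{j ∈ J} Σ_{i ∈ I} #{a ∈ A : a j = i}·(w_T(j)·w_S(i))`.
[folklore] -/
private theorem hubBlockCard_sum_hit_eq {n : ℕ} (A : Finset (Equiv.Perm (Fin n)))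
    (J I : Finset (Fin n)) (wT wS : Fin n → ℝ) :
    ∑ a ∈ A, ∑ j ∈ J, (if a j ∈ I then wT j * wS (a j) else 0) =
      ∑ j ∈ J, ∑ i ∈ I, ((A.filter fun a => a j = i).card : ℝ) * (wT j * wS i) := by
  classical
  rw [Finset.sum_comm]
  refine Finset.sum_congr rfl fun j _ => ?_
  have key : ∀ a : Equiv.Perm (Fin n), (if a j ∈ I then wT j * wS (a j) else 0) =
      ∑ i ∈ I, (if a j = i then wT j * wS i else 0) := fun a =>
    (Finset.sum_ite_eq I (a j) fun i => wT j * wS i).symm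
  simp_rw [key]
  rw [Finset.sum_comm]
  refine Finset.sum_congr rfl fun i _ => ?_
  rw [Finset.sum_ite, Finset.sum_const_zero, add_zero, Finset.sum_const, nsmul_eq_mul]

/-- The block-cost step for an abstract set `A ⊆ S_n` of size `N > 0` whose marginals are
`#{a ∈ A : a j = i} = N·d_A(i,j)`: with weights `w_T ∈ [β, 2β]` on `J₀`, `w_S ∈ [γ, 2γ]` on `I₀`,
masses `Σ_{J₀} w_T, Σ_{I₀} w_S ≥ 2q` and `Σ_{I₀ × J₀} d_A·w_T·w_S ≤ η/n`, `η ≤ 2q²`, the block is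
small: `|J₀|·|I₀| ≤ 9600·(1 + log n)·n·log(6·n!/N)` (`block_cost` with `ρ = 2`). [folklore] -/
private theorem hubBlockCard_of_marginals {n : ℕ} (hn : 1 ≤ n) (A : Finset (Equiv.Perm (Fin n)))
    (N : ℕ) (hN : 0 < N) (hAcard : A.card = N) (dA : Fin n → Fin n → ℝ) (wT wS : Fin n → ℝ)
    (hmarg : ∀ i j, ((A.filter fun a => a j = i).card : ℝ) = N * dA i j)
    (J₀ I₀ : Finset (Fin n)) (β γ q η : ℝ) (hβ : 0 < β) (hγ : 0 < γ) (hq : 0 < q)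
    (hJ₀ : ∀ j ∈ J₀, β ≤ wT j ∧ wT j ≤ 2 * β) (hI₀ : ∀ i ∈ I₀, γ ≤ wS i ∧ wS i ≤ 2 * γ)
    (hσ : 2 * q ≤ ∑ j ∈ J₀, wT j) (hρ : 2 * q ≤ ∑ i ∈ I₀, wS i)
    (hΨ : ∑ i ∈ I₀, ∑ j ∈ J₀, dA i j * wT j * wS i ≤ η / n) (hηq : η ≤ 2 * q ^ 2) :
    (J₀.card : ℝ) * I₀.card ≤ 9600 * (1 + Real.log n) * n * Real.log (6 * n.factorial / N) := by
  classical
  have hnR : (0 : ℝ) < n := by exact_mod_cast hn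
  have hNR : (0 : ℝ) < N := by exact_mod_cast hN
  have hA0 : A.Nonempty := Finset.card_pos.1 (hAcard ▸ hN)
  -- the deficit hypothesis of `block_cost`
  have hdef : ∑ a ∈ A, ∑ j ∈ J₀, (if a j ∈ I₀ then wT j * wS (a j) else 0) ≤
      (A.card : ℝ) * ((∑ j ∈ J₀, wT j) * (∑ i ∈ I₀, wS i) / n) / 2 := by
    rw [hubBlockCard_sum_hit_eq, hAcard]
    have hL : ∑ j ∈ J₀, ∑ i ∈ I₀, ((A.filter fun a => a j = i).card : ℝ) * (wT j * wS i) =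
        N * ∑ i ∈ I₀, ∑ j ∈ J₀, dA i j * wT j * wS i := by
      rw [Finset.sum_comm, Finset.mul_sum]
      refine Finset.sum_congr rfl fun i _ => ?_
      rw [Finset.mul_sum]
      refine Finset.sum_congr rfl fun j _ => ?_
      rw [hmarg]; ring
    rw [hL]
    have h2q : 0 ≤ 2 * q := by linarith only [hq]
    have h4 : 2 * q * (2 * q) ≤ (∑ j ∈ J₀, wT j) * (∑ i ∈ I₀, wS i) :=
      mul_le_mul hσ hρ h2q (h2q.trans hσ)
    have hkey : η ≤ (∑ j ∈ J₀, wT j) * (∑ i ∈ I₀, wS i) / 2 := by nlinarith only [h4, hηq]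
    have hdiv : η / n ≤ (∑ j ∈ J₀, wT j) * (∑ i ∈ I₀, wS i) / 2 / n :=
      div_le_div_of_nonneg_right hkey hnR.le
    calc (N : ℝ) * ∑ i ∈ I₀, ∑ j ∈ J₀, dA i j * wT j * wS i ≤ N * (η / n) :=
          mul_le_mul_of_nonneg_left hΨ hNR.le
      _ ≤ N * ((∑ j ∈ J₀, wT j) * (∑ i ∈ I₀, wS i) / 2 / n) :=
          mul_le_mul_of_nonneg_left hdiv hNR.le
      _ = (N : ℝ) * ((∑ j ∈ J₀, wT j) * (∑ i ∈ I₀, wS i) / n) / 2 := by ring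
  have hbc := block_cost hn A hA0 J₀ I₀ wT wS β γ 2 hβ hγ (by norm_num) hJ₀ hI₀ hdef
  rw [hAcard] at hbc
  calc (J₀.card : ℝ) * I₀.card
      ≤ 600 * 2 ^ 4 * (1 + Real.log n) * n * Real.log (6 * n.factorial / N) := hbc
    _ = 9600 * (1 + Real.log n) * n * Real.log (6 * n.factorial / N) := by norm_num

set_option maxHeartbeats 800000 in
/-- **Stub `hubBlock_card_le` — the block-cost step of the dyadic hub lemma.** For a TPP triple
`S, T, U ⊆ S_n` (`n ≥ 1`, all non-empty) with quotient profiles `dA, dB, dC`, a hub position `k`,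
dyadic blocks `J₀` (`dB(·,k) ∈ [β, 2β]`) and `I₀` (`dC(k,·) ∈ [γ, 2γ]`) of masses at least `2q`, and
`Σ_{I₀ × J₀} dA·dB·dC ≤ η/n` with `η ≤ 2q²`:
`|J₀|·|I₀| ≤ 9600·(1 + log n)·n·log(6·n!/(|S||T|))`. Proof: `block_cost` for the quotient set
`A = S⁻¹T` (`|A| = |S||T|`, marginals `|S||T|·dA`) with weights `dB(·,k)`, `dC(k,·)` and `ρ = 2`.
[folklore] -/
theorem hubBlock_card_le {n : ℕ} (hn : 1 ≤ n) {S T U : Finset (Equiv.Perm (Fin n))}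
    (hTPP : TripleProductProperty S T U) (hS0 : S.Nonempty) (hT0 : T.Nonempty) (hU0 : U.Nonempty)
    (dA dB dC : Fin n → Fin n → ℝ)
    (hdA : ∀ i j, dA i j = (((S ×ˢ T).filter fun st => st.2 j = st.1 i).card : ℝ) / (S.card * T.card : ℕ))
    (hdB : ∀ j k, dB j k = (((T ×ˢ U).filter fun tu => tu.2 k = tu.1 j).card : ℝ) / (T.card * U.card : ℕ))
    (hdC : ∀ k i, dC k i = (((U ×ˢ S).filter fun us => us.2 i = us.1 k).card : ℝ) / (U.card * S.card : ℕ))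
    (k : Fin n) (J₀ I₀ : Finset (Fin n)) (β γ q η : ℝ) (hβ : 0 < β) (hγ : 0 < γ) (hq : 0 < q)
    (hJ₀ : ∀ j ∈ J₀, β ≤ dB j k ∧ dB j k ≤ 2 * β) (hI₀ : ∀ i ∈ I₀, γ ≤ dC k i ∧ dC k i ≤ 2 * γ)
    (hσ : 2 * q ≤ ∑ j ∈ J₀, dB j k) (hρ : 2 * q ≤ ∑ i ∈ I₀, dC k i)
    (hΨ : ∑ i ∈ I₀, ∑ j ∈ J₀, dA i j * dB j k * dC k i ≤ η / n) (hηq : η ≤ 2 * q ^ 2) :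
    (J₀.card : ℝ) * I₀.card ≤
      9600 * (1 + Real.log n) * n * Real.log (6 * n.factorial / (S.card * T.card : ℕ)) := by
  classical
  -- the profiles `dB`, `dC` enter only through the weights `dB(·,k)`, `dC(k,·)`
  have _ := hdB
  have _ := hdC
  -- the quotient set `A = S⁻¹T`: `|A| = |S||T|`, marginals `|S||T|·dA`
  have hinj := injOn_quot_first hTPP hU0
  have hAcard := card_image₂_of_injOn' hinj
  have hST0 : 0 < S.card * T.card := Nat.mul_pos hS0.card_pos hT0.card_pos
  have hSTR : ((S.card * T.card : ℕ) : ℝ) ≠ 0 := by exact_mod_cast hST0.ne'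
  have hmarg : ∀ i j, (((Finset.image₂ (fun x y : Equiv.Perm (Fin n) => x⁻¹ * y) S T).filter
      fun a => a j = i).card : ℝ) = ((S.card * T.card : ℕ) : ℝ) * dA i j := by
    intro i j
    rw [← pairMarginal_eq_marginal_image₂ hinj i j, hdA, mul_div_assoc', mul_div_cancel_left₀ _ hSTR]
  exact hubBlockCard_of_marginals hn _ (S.card * T.card) hST0 hAcard dA (fun j => dB j k)
    (fun i => dC k i) hmarg J₀ I₀ β γ q η hβ hγ hq hJ₀ hI₀ hσ hρ hΨ hηq

end Summit.MatrixMultiplication.MatrixMultiplication.Theorems.PolynomialSlack
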